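/-
Copyright (c) 2026 the pub-hodgecm-mathlib formalisation cell (harness21).  Prover seat hodgecm-mathlib-F0P3a-p01 (g33), req620 Track A «(D-RAM) FOUR-FRAME» squad, unit U2H:
the (ρ2b′-X) child (U2H ED. 15 :418) — organ T3-E part 2, FILE C «THE INTEGRAL GENERATOR `α` AND `hint`» (plan `T3E-PART2-PLAN.v1` 333f6514 §2 (g), made CASE-FREE;
payer lineage LH4-p14, O-W LH4-p12 (g4)).  2026-09-04.
-/
import Mathlib.Topology.Algebra.Valued.ValuationTopology
import HarnessLib

/-!
# Crux `H413`, line LH4 «(D-RAM) FOUR-FRAME» road — unit U2H, (ρ2b′-X), organ T3-E part 2, FILE C: THE INTEGRAL GENERATOR `α` OF A VALUED FIELD WITH INVOLUTION (`hα`, `hα1`, `hint`)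

Cell `hodgecm-mathlib` (D-0151), FLOOR 0, crux item H413 = `stmt-HodgeConjecture-24833`, route of record `HCCMUnconditional`; squad F0∕P3c∕LH4; registered stub served:
`F0P3cDyRamFourFrameU2H.stub_U2H_fixedPointCensus_typeTwo_unit0` ((ρ2b′-X), U2H ED. 15 :418) through the organs of RHO2BX-ORDER v1 — here T3-E part 2 FILE C (★ FILE A p857347,
FILE B `F0P3cDyRamEigenFieldAdjointInvolution`, ★ part 1 p857255).  THEOREMS ONLY (no `def`, no instance, no notation, no `sorry`); lane `--supports stmt-HodgeConjecture-24833 --as helper`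
(count-neutral).

WHAT THIS FILE DOES.  The binders `(hα : ρ α ≠ α) (hα1 : |α| ≤ 1) (hint : ∀ z, |z| ≤ 1 → |(z − ρz)∕(α − ρα)| ≤ 1)` of ★ (C) `EllipticPlaneAsFieldLine.ncard_selfDual_fixed_eq_ncard_orderLatt`
(p857215), of ★ T4 `QuadraticOrderLattices` ∕ `QuadraticOrderHermitianDual` and of ★ (W4) `F0P3cDyRamWSideOrderCensus` say: `α` is an integral element at which `|z − ρz|` is MAXIMAL over
the valuation ring (then `{z ∈ 𝒪 | |z − ρz| ≤ |c|·|α − ρα|} = 𝒪^ρ + c·𝒪`, the orders of ★ T4).  For ANY field `M` with a `ℤᵐ⁰`-valuation and an ISOMETRIC ring map `ρ` moving some element,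
such an `α` EXISTS — no case split on the ramification of `M ∕ M^ρ` is needed (plan §2 (g) asked for ★ T4's unit `α` with `|α − ρα| = 1` in the unramified frame and a uniformiser in
the ramified frames; both ARE maximisers, and every consumer reads `α` only through `|α − ρα|`):
* `exists_integer_map_ne` — an isometric `ρ ≠ id` moves an INTEGRAL element (invert a non-integral one);
* `v_sub_map_le_one` — `|z − ρz| ≤ 1` on the valuation ring;
* **`exists_integralGenerator`** — `∃ α, ρ α ≠ α ∧ |α| ≤ 1 ∧ ∀ z, |z| ≤ 1 → |(z − ρz)∕(α − ρα)| ≤ 1` (the values `|z − ρz|`, `z ∈ 𝒪`, lie in `{0} ∪ {exp(−n)}`; take the least `n`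
  attained — `Nat.find`).
HONEST LABEL.  Count-neutral helper (elementary valuation theory); (ρ2b′-X) stays an OPEN prover target; `HC_CM` is proved only modulo the 7 printed citations (2 remaining named inputs:
hLiu418 = `stmt-HodgeConjecture-24832`, h413 = `stmt-HodgeConjecture-24833`) until rung 0 closes.

## References
* [SerreLocalFields1979] J.-P. Serre, *Local Fields*, GTM 67 (1979), Ch. III §6 Prop. 12 (orders `𝒪_K + 𝔣𝒪_L` of a quadratic extension and their conductors), Ch. I §6 Prop. 17–18
  (monogenic integers: `𝒪_L = 𝒪_K[α]`).
* [Jacobowitz1962] R. Jacobowitz, *Hermitian forms over local fields*, Amer. J. Math. 84 (1962), §4 (the integral generator of `𝒪_E` over `𝒪_F` used to norm hermitian lattices).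
-/

set_option autoImplicit false

noncomputable section

open WithZero

namespace Summit.HodgeConjecture.HodgeConjecture.Cruxes.H413.F0P3cDyRamIntegralInvolutionGenerator

variable {M : Type} [Field M] [Valued M ℤᵐ⁰]

/-- An isometric ring map that moves some element moves an INTEGRAL one (if `|z| > 1`, use `z⁻¹`). [cite: SerreLocalFields1979, Ch. I §6 Prop. 17–18] -/
theorem exists_integer_map_ne (ρ : M →+* M) (hρ : ∃ z, ρ z ≠ z) : ∃ z : M, Valued.v z ≤ 1 ∧ ρ z ≠ z := by
  obtain ⟨z, hz⟩ := hρ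
  by_cases h1 : Valued.v z ≤ 1
  · exact ⟨z, h1, hz⟩
  · have hz0 : z ≠ 0 := fun h0 => by rw [h0, map_zero] at h1; exact h1 zero_le_one
    refine ⟨z⁻¹, ?_, fun h => hz ?_⟩
    · rw [map_inv₀]; exact inv_le_one_of_one_le₀ (le_of_lt (not_le.1 h1))
    · rw [map_inv₀] at h; exact inv_injective h

/-- On the valuation ring `|z − ρz| ≤ 1` for an isometric `ρ`. [cite: SerreLocalFields1979, Ch. III §6 Prop. 12] -/
theorem v_sub_map_le_one (ρ : M →+* M) (hvρ : ∀ z, Valued.v (ρ z) = Valued.v z) {z : M} (hz : Valued.v z ≤ 1) : Valued.v (z - ρ z) ≤ 1 :=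
  (Valuation.map_sub _ _ _).trans (max_le hz (by rw [hvρ]; exact hz))

/-- A nonzero value `x ≤ 1` in `ℤᵐ⁰` is `exp (−n)` for some `n : ℕ`. [cite: SerreLocalFields1979, Ch. I §6 Prop. 17–18] -/
theorem exists_eq_exp_neg_natCast {x : ℤᵐ⁰} (hx0 : x ≠ 0) (hx1 : x ≤ 1) : ∃ n : ℕ, x = exp (-(n : ℤ)) := by
  have hlog : log x ≤ 0 := by rw [← exp_le_exp, exp_log hx0, exp_zero]; exact hx1
  refine ⟨(-log x).toNat, ?_⟩
  rw [Int.toNat_of_nonneg (by omega), neg_neg, exp_log hx0]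

/-- **T3-E FILE C — THE INTEGRAL GENERATOR.**  For a field `M` with a `ℤᵐ⁰`-valuation and an isometric ring map `ρ : M →+* M` moving some element, there is `α ∈ M` with `ρ α ≠ α`,
`|α| ≤ 1`, and `|(z − ρz)∕(α − ρα)| ≤ 1` for every `z` with `|z| ≤ 1` — an integral element MAXIMISING `|z − ρz|` over the valuation ring (the binders `hα hα1 hint` of ★ (C)
`EllipticPlaneAsFieldLine.ncard_selfDual_fixed_eq_ncard_orderLatt` and ★ (W4) `F0P3cDyRamWSideOrderCensus`). [cite: SerreLocalFields1979, Ch. III §6 Prop. 12; Ch. I §6 Prop. 17–18]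
[cite: Jacobowitz1962, §4] -/
theorem exists_integralGenerator (ρ : M →+* M) (hvρ : ∀ z, Valued.v (ρ z) = Valued.v z) (hρ : ∃ z, ρ z ≠ z) :
    ∃ α : M, ρ α ≠ α ∧ Valued.v α ≤ 1 ∧ ∀ z : M, Valued.v z ≤ 1 → Valued.v ((z - ρ z) / (α - ρ α)) ≤ 1 := by
  classical
  -- the attained levels `n` of `|z − ρz| = exp(−n)`, `z` integral
  let P : ℕ → Prop := fun n => ∃ z : M, Valued.v z ≤ 1 ∧ Valued.v (z - ρ z) = exp (-(n : ℤ))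
  have hP : ∃ n, P n := by
    obtain ⟨z, hz1, hz⟩ := exists_integer_map_ne ρ hρ
    have h0 : Valued.v (z - ρ z) ≠ 0 := (Valuation.ne_zero_iff _).2 (sub_ne_zero.2 (Ne.symm hz))
    obtain ⟨n, hn⟩ := exists_eq_exp_neg_natCast h0 (v_sub_map_le_one ρ hvρ hz1)
    exact ⟨n, z, hz1, hn⟩
  obtain ⟨α, hα1, hα⟩ := Nat.find_spec hP
  refine ⟨α, fun h => ?_, hα1, fun z hz => ?_⟩
  · -- `ρ α ≠ α`: its level is a genuine `exp(−n₀) ≠ 0`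
    have : Valued.v (α - ρ α) = 0 := by rw [h, sub_self, map_zero]
    rw [hα] at this
    exact exp_ne_zero this
  · -- maximality: `|z − ρz| ≤ |α − ρα|`
    have hd0 : Valued.v (α - ρ α) ≠ 0 := by rw [hα]; exact exp_ne_zero
    rw [map_div₀, div_le_one₀ (zero_lt_iff.2 hd0)]
    by_cases hz0 : Valued.v (z - ρ z) = 0
    · rw [hz0]; exact zero_le
    · obtain ⟨n, hn⟩ := exists_eq_exp_neg_natCast hz0 (v_sub_map_le_one ρ hvρ hz)
      have hmin : Nat.find hP ≤ n := Nat.find_min' hP ⟨z, hz, hn⟩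
      rw [hn, hα, exp_le_exp]
      omega

end Summit.HodgeConjecture.HodgeConjecture.Cruxes.H413.F0P3cDyRamIntegralInvolutionGenerator

end
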